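import Summits.ABC.IUTFork.Cor312FrameVolumePiecesDH
import Summits.ABC.IUTFork.Cor312HullDefinedDHVolArch
import HarnessLib

/-!
# [IUTchIII] Corollary 3.12, statement — the field-box volume pieces WITH THE RADIAL ARCHIMEDEAN FACTORS at the
# real log-shells (archimedean place honest), and container-robustness versus `Real.settingDHVolArch`

Record-only file (D-0012) of the abc-iut cell (Cor. 3.12 sub-crew, seat abc-iut-c312-6, gen 5; TEAM B real-setting
lane; TEAM A row A-0 leftover (4) «archimedean radial container vs DH convention» at the FRAMES level); TAKES NO SIDE.
The companion `Cor312FrameVolumePiecesDH` inhabits c312-6's `Cor312Vol.FrameVolumePieces` at the Dupuy–Hilado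
real log-shells with the DH convention at `∞` (EMPTY factor index: every archimedean packet contributes `0`, the
modelling choice of `Cor312VolumesRealAssembly`; audit note N1 on p424654). abc-iut-w5-d163's `Cor312VolumesRealArch`/
`Cor312SettingDHVolArch` make the archimedean place HONEST: field factors at `∞` = the copies of `ℂ` of L5-t7's canonical
decomposition `Φ₀ : M_I ≅ ⊕_{(w,ε)} ℂ` ([IUTchIV] Prop. 1.5 (iii)), comparison `Φ₀ ∘ e`, archimedean frame
`HullFrame.ofNormSurjective`, verbatim container = L5-t7's normalised packet log-volume (`ArchPresentation.logμ`). THIS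
file gives the field-box pieces over THOSE factors with, at `∞`, the RADIAL factor volume of [IUTchIII] Rmk. 3.1.1
(iii) / [AbsTopIII] Prop. 5.7 (ii) — c312-6's `FactorVolume.complexRadial` (`μ(A) = length(pr_ℝ A)`,
`μ̇^log(x) = log ‖x‖`) — exactly the archimedean half of c312-6's `Cor312VolumesRealFrames` design, now AT THE DATA OF THE
SETTING OF RECORD:

* §1 `Real.frameVolumePiecesDHArch X hlog hc : FrameVolumePieces (Real.logShellsDH X logv)` — J/K/e/frames =
  w5-d163's `factorIdxDHArch`/`factorFieldDHArch`/`factorMapDHArch`/`frameKDHArch` (onto: `factorMapDHArch_surjective`);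
  factor volumes: `complexRadial` on every copy of `ℂ` at `∞`, Haar normalised at `𝒪` at the primes (companion
  `PadicPresentation.factorVolume`); weights: `|J|⁻¹` on every copy of `ℂ` at `∞` (L5-t7's normalisation "divide by
  `dim_ℝ`": `nlogVol_polydisc` = the AVERAGE of the log-radii), `w_{v⃗}/D_{v⃗}` at the primes (companion `frameWeight`).
  Hypothesis-free specialisation `frameVolumePiecesDHArchAnalytic` (the type's `Nonempty` record is the companion's).
* §2 **AGREEMENT ON HULL-SETS at every place, archimedean place included**: the field-box log-volume of
  `(Φ₀∘e)⁻¹(Π_s λ_s·𝒪_ℂ)` is `|J|⁻¹·Σ_s log ‖λ_s‖` (`complexRadial_mulLogvol`) = the verbatim container's value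
  (w5-d163 `ArchPresentation.logμ_preimage_polydisc` = L5-t7 `nlogVol_polydisc`; `e_image_preimage`); at the primes as
  in the companion (abc-iut-w4-d036's closed form + abc-iut-S8's Haar modulus).
* §3 the twin `Real.situationDHFramesArch`/`Real.settingDHFramesArch` (`Setting.ofFrames` over the pieces'
  `toRealFrames thetaBox qCentre`, `hadm` DISCHARGED by c312-6 `hadm_of_realizes`, binders EXACTLY those of
  `Real.settingDHVolArch`, `hfin` transported) and **CONTAINER-ROBUSTNESS** versus `Real.settingDHVolArch`: same frames /
  possible images / `q`-region / hull / `HullDefined` by `rfl`; same `qLocal`, `thetaLocal`, `ThetaFinite`,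
  `negLogTheta`, `negLogQ`; **`statement_settingDHFramesArch_iff`**. So w5-d163's archimedean-honest theorems
  (`thetaLocal_settingDHVolArch_inl = (j+1)·log π`, `bridgeHyps_settingDHVolArch`, …) and every frames-route theorem
  over `variable (V : FrameVolumePieces L)` meet at `V := frameVolumePiecesDHArch`.
[claim: Mochizuki2012, status: disputed] for the quoted container; [cite: MochizukiAbsTopIII2015, Prop. 5.7 (ii) p. 138]
(radial log-volume); [cite: Mochizuki2012, IUTchIV Prop. 1.5 (iii) p. 15] (the copies of `ℂ`). Everything proved is
bookkeeping. Deliberately NOT here: Θ-boxes / `q`-centre (binders), `IsSettingOf`, any judgement. Typed ≠ proved;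
instantiated ≠ endorsed.
-/

noncomputable section

open Set Function MeasureTheory Metric NumberField
open scoped Pointwise ENNReal

namespace Summit.ABC

namespace IUTFork

namespace Thm311

namespace Real

open Cor312 Cor312Vol Literature.IUT.LogThetaLattice Literature.IUT.LogVolume

variable {F : Type} [Field F] [NumberField F] (X : PilotData F) {logv : PadicLogs F} (hlog : LogvAnalytic logv)
  (hc : ∀ w : InfinitePlace F, w.IsComplex)

/-! ## §1. The pieces with radial archimedean factors -/

/-- The factor volumes, archimedean place honest: the RADIAL volume `complexRadial` ([AbsTopIII] Prop. 5.7 (ii):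
`μ(A) = length(pr_ℝ A)`, `μ(𝒪_ℂ) = 1`) on every copy of `ℂ` at `∞`; Haar normalised at `𝒪` at a prime.
[cite: MochizukiAbsTopIII2015, Prop. 5.7 (ii) p. 138] -/
def factorVolumeDHArch : ∀ (j : (thetaIndex X).Label) (vQ : (thetaIndex X).VQ) (s : factorIdxDHArch X hlog j vQ),
    FactorVolume (factorFieldDHArch X hlog j vQ s)
  | _, .inl _, _ => FactorVolume.complexRadial
  | j, .inr pp, s => by
    haveI : Fact (pp : ℕ).Prime := ⟨pp.2⟩
    exact (presAt X hlog pp).factorVolume j s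

/-- The frame weights, archimedean place honest: `|J|⁻¹` on every copy of `ℂ` at `∞` (L5-t7's normalisation of the
archimedean packet log-volume: divide by `dim_ℝ M_I = 2|J|`, radial log-volume = half the Lebesgue log-volume, so the
hull-set value is the AVERAGE of the log-radii, `nlogVol_polydisc`); `w_{v⃗}/D_{v⃗}` at a prime.
[cite: Mochizuki2012, IUTchIII Prop. 3.9 (i) p. 115] -/
def frameWeightDHArch : ∀ (j : (thetaIndex X).Label) (vQ : (thetaIndex X).VQ), factorIdxDHArch X hlog j vQ → ℝ
  | j, .inl u => fun _ => ((Fintype.card (factorIdxDHArch X hlog j (.inl u)) : ℝ))⁻¹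
  | j, .inr pp => by
    haveI : Fact (pp : ℕ).Prime := ⟨pp.2⟩
    exact fun s => (presAt X hlog pp).frameWeight j s

/-- The frame weights are nonnegative. [folklore] -/
theorem frameWeightDHArch_nonneg : ∀ (j : (thetaIndex X).Label) (vQ : (thetaIndex X).VQ)
    (s : factorIdxDHArch X hlog j vQ), 0 ≤ frameWeightDHArch X hlog j vQ s
  | _, .inl _, _ => inv_nonneg.mpr (Nat.cast_nonneg _)
  | j, .inr pp, s => by
    haveI : Fact (pp : ℕ).Prime := ⟨pp.2⟩
    exact (presAt X hlog pp).frameWeight_nonneg j s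

/-- **The field-box volume pieces of the REAL log-shells of `F`, archimedean place HONEST** (under "`√−1 ∈ F`": every
archimedean place complex): w5-d163's field-factor frames (c312-3's decomposition fields at the primes, the copies of
`ℂ` of `Φ₀` at `∞`; comparison `factorMapDHArch`, onto; frames `frameKDHArch` with hull-sets `λ·𝒪_L`), the factor
volumes RADIAL at `∞` / Haar at `p`, weights `|J|⁻¹` / `w_{v⃗}/D_{v⃗}` — [IUTchIII] Rmk. 3.1.1 (ii)(iii) read as boxes over
the field factors, archimedean factors included. [claim: Mochizuki2012, status: disputed] -/
def frameVolumePiecesDHArch : FrameVolumePieces (logShellsDH X logv) where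
  J := factorIdxDHArch X hlog
  instFintype := factorIdxDHArch_fintype X hlog
  K := factorFieldDHArch X hlog
  instField := factorFieldDHArch_field X hlog
  e := factorMapDHArch X hlog hc
  e_surjective j vQ := factorMapDHArch_surjective X hlog hc j vQ
  vol := factorVolumeDHArch X hlog
  w := frameWeightDHArch X hlog
  w_nonneg := frameWeightDHArch_nonneg X hlog
  frameK := frameKDHArch X hlog
  hul_iff := frameKDHArch_hul_iff X hlog

/-- The pieces for c312-5's ANALYTIC logarithm family — no hypothesis beyond `X` and "`√−1 ∈ F`".
[claim: Mochizuki2012, status: disputed] -/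
def frameVolumePiecesDHArchAnalytic : FrameVolumePieces (logShellsDH X (analyticLogv F)) :=
  frameVolumePiecesDHArch X (logvAnalytic_analyticLogv (F := F)) hc

/-- The comparison of the pieces IS w5-d163's `factorMapDHArch`. [folklore] -/
theorem frameVolumePiecesDHArch_e : (frameVolumePiecesDHArch X hlog hc).e = factorMapDHArch X hlog hc := rfl

/-! ## §2. Agreement with the verbatim container on hull-sets, archimedean place included -/

section Agreement

variable (M : Type) [Field M] [NumberField M]
  (archPk : ∀ (j : (thetaIndex X).Label) (vQ : (thetaIndex X).VQ), Set ((logShellsDH X logv).Packet j vQ))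
  (archSub : ∀ (j : (thetaIndex X).Label) (v : (thetaIndex X).V),
    Set ((logShellsDH X logv).Packet j ((thetaIndex X).over v)))
  (Ψ : ℤ → ∀ v : (thetaIndex X).V, v ∈ (thetaIndex X).Vbad → Set ((logShellsDH X logv).StarPacket v))
  (act : ℤ → ∀ v : (thetaIndex X).V, v ∈ (thetaIndex X).Vbad →
    (logShellsDH X logv).StarPacket v → Module.End ℚ ((logShellsDH X logv).StarPacket v))
  (Mmod : ℤ → ∀ j : (thetaIndex X).LabelStar, Set ((logShellsDH X logv).GlobalPacket j.1))
  (region : ℤ → ∀ j : (thetaIndex X).LabelStar, FinDivisor M → ∀ vQ : (thetaIndex X).VQ,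
    Set ((logShellsDH X logv).Packet j.1 vQ))
  (n : ℤ)

/-- **At `∞`: the field-box log-volume of `(Φ₀∘e)⁻¹(Π_s λ_s·𝒪_ℂ)` is the AVERAGE of the radial log-volumes
`log ‖λ_s‖`** (`complexRadial_mulLogvol`). [cite: MochizukiAbsTopIII2015, Prop. 5.7 (ii)(b) p. 138] -/
theorem logvol_frameVolumePiecesDHArch_preimage_hullSet_inl (j : (thetaIndex X).Label)
    (c : ∀ s : factorIdxDHArch X hlog j (.inl ()), factorFieldDHArch X hlog j (.inl ()) s) :
    (frameVolumePiecesDHArch X hlog hc).logvol j (.inl ())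
        (factorMapDHArch X hlog hc j (.inl ()) ⁻¹' hullSet (factorFieldDHArch X hlog j (.inl ())) c) =
      ((Fintype.card (factorIdxDHArch X hlog j (.inl ())) : ℝ))⁻¹ * ∑ s, Real.log ‖c s‖ := by
  rw [show factorMapDHArch X hlog hc j (.inl ()) ⁻¹' hullSet (factorFieldDHArch X hlog j (.inl ())) c =
      (frameVolumePiecesDHArch X hlog hc).e j (.inl ()) ⁻¹' hullSet ((frameVolumePiecesDHArch X hlog hc).K j (.inl ())) c
      from rfl, (frameVolumePiecesDHArch X hlog hc).logvol_preimage_hullSet j (.inl ()) c, Finset.mul_sum]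
  refine Finset.sum_congr rfl fun s _ => ?_
  show ((Fintype.card (factorIdxDHArch X hlog j (.inl ()))) : ℝ)⁻¹ * FactorVolume.complexRadial.mulLogvol (c s) = _
  rw [FactorVolume.complexRadial_mulLogvol]
  rfl

/-- **At `∞`: the verbatim container of `Real.situationDHVolArch` on the same set is the same number** (L5-t7's
normalised packet log-volume of the polydisc of radii `‖λ_s‖ > 0` = the average of the log-radii:
w5-d163 `ArchPresentation.logμ_preimage_polydisc`, `e_image_preimage`). [claim: Mochizuki2012, status: disputed] -/
theorem logvol_situationDHVolArch_preimage_hullSet_inl (j : (thetaIndex X).Label)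
    (c : ∀ s : factorIdxDHArch X hlog j (.inl ()), factorFieldDHArch X hlog j (.inl ()) s) (hc0 : ∀ s, c s ≠ 0) :
    ((situationDHVolArch X hlog hc M archPk archSub Ψ act Mmod region).D n).logvol j (.inl ())
        (factorMapDHArch X hlog hc j (.inl ()) ⁻¹' hullSet (factorFieldDHArch X hlog j (.inl ())) c) =
      ((Fintype.card (factorIdxDHArch X hlog j (.inl ())) : ℝ))⁻¹ * ∑ s, Real.log ‖c s‖ := by
  have hr : ∀ s : factorIdxDHArch X hlog j (.inl ()), 0 < ‖c s‖ := fun s => norm_pos_iff.mpr (hc0 s)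
  show (summandPiecesDHArch X hlog hc).logvol j (.inl ()) _ = _
  refine (congrArg ((summandPiecesDHArch X hlog hc).logvol j (.inl ()))
    (factorMapDHArch_preimage_hullSet_inl X hlog hc j c)).trans ?_
  rw [SummandPieces.logvol_eq_of_pi (R := fun _ : Unit => _) ((archPresentationDH X logv hc).e_image_preimage j _)
      (fun _ => ArchPresentation.adm_preimage_polydisc j hr)]
  show ∑ _u : Unit, (1 : ℝ) * ArchPresentation.logμ (T := thetaIndex X) (Sum.inl ()) j _ = _
  rw [Fintype.sum_unique, one_mul]
  exact ArchPresentation.logμ_preimage_polydisc j hr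

/-- **Field-box log-volume = verbatim log-volume on hull-set preimages, at EVERY place, archimedean place honest**
(for `λ_s ≠ 0`): at `∞` by the two lemmas above; at a prime as in the companion (`sum_frameWeight_mul_mulLogvol`).
[claim: Mochizuki2012, status: disputed] [cite: MochizukiAbsTopIII2015, Prop. 5.7 (i)(ii) pp. 137–138] -/
theorem logvol_frameVolumePiecesDHArch_preimage_hullSet : ∀ (j : (thetaIndex X).Label) (vQ : (thetaIndex X).VQ)
    (c : ∀ s : factorIdxDHArch X hlog j vQ, factorFieldDHArch X hlog j vQ s), (∀ s, c s ≠ 0) →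
    (frameVolumePiecesDHArch X hlog hc).logvol j vQ
        (factorMapDHArch X hlog hc j vQ ⁻¹' hullSet (factorFieldDHArch X hlog j vQ) c) =
      ((situationDHVolArch X hlog hc M archPk archSub Ψ act Mmod region).D n).logvol j vQ
        (factorMapDHArch X hlog hc j vQ ⁻¹' hullSet (factorFieldDHArch X hlog j vQ) c)
  | j, .inl u, c, hc0 => by
    cases u
    rw [logvol_frameVolumePiecesDHArch_preimage_hullSet_inl X hlog hc j c,
      logvol_situationDHVolArch_preimage_hullSet_inl X hlog hc M archPk archSub Ψ act Mmod region n j c hc0]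
  | j, .inr pp, c, hc0 => by
    haveI : Fact (pp : ℕ).Prime := ⟨pp.2⟩
    letI hCF : Fintype ((thetaIndex X).Caps j → (thetaIndex X).Fibre (.inr pp)) := Fintype.ofFinite _
    rw [show factorMapDHArch X hlog hc j (.inr pp) ⁻¹' hullSet (factorFieldDHArch X hlog j (.inr pp)) c =
        (frameVolumePiecesDHArch X hlog hc).e j (.inr pp) ⁻¹' hullSet ((frameVolumePiecesDHArch X hlog hc).K j (.inr pp)) c
        from rfl, (frameVolumePiecesDHArch X hlog hc).logvol_preimage_hullSet j (.inr pp) c]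
    show (∑ s : (presAt X hlog pp).factorIdx j, (presAt X hlog pp).frameWeight j s *
        ((presAt X hlog pp).factorVolume j s).mulLogvol (c s)) =
      ((situationDHVolArch X hlog hc M archPk archSub Ψ act Mmod region).D n).logvol j (.inr pp)
        (factorMapDHArch X hlog hc j (.inr pp) ⁻¹' hullSet (factorFieldDHArch X hlog j (.inr pp)) c)
    exact (presAt X hlog pp).sum_frameWeight_mul_mulLogvol j c hc0

/-- The same for an arbitrary hull-set `H = λ·𝒪_L`. [claim: Mochizuki2012, status: disputed] -/
theorem logvol_frameVolumePiecesDHArch_preimage_of_isHullSet (j : (thetaIndex X).Label) (vQ : (thetaIndex X).VQ)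
    {H : Set (∀ s : factorIdxDHArch X hlog j vQ, factorFieldDHArch X hlog j vQ s)}
    (hH : IsHullSet (factorFieldDHArch X hlog j vQ) H) :
    (frameVolumePiecesDHArch X hlog hc).logvol j vQ (factorMapDHArch X hlog hc j vQ ⁻¹' H) =
      ((situationDHVolArch X hlog hc M archPk archSub Ψ act Mmod region).D n).logvol j vQ
        (factorMapDHArch X hlog hc j vQ ⁻¹' H) := by
  obtain ⟨c, hc0, rfl⟩ := hH
  exact logvol_frameVolumePiecesDHArch_preimage_hullSet X hlog hc M archPk archSub Ψ act Mmod region n j vQ c hc0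

/-! ## §3. The twin setting with radial archimedean factors, and container-robustness -/

/-- The situation of Thm. 3.11 over the real log-shells WITH THE FIELD-BOX VOLUMES, archimedean factors radial.
[claim: Mochizuki2012, status: disputed] -/
abbrev situationDHFramesArch : Situation (thetaIndex X) :=
  Situation.ofShells (logShellsDH X logv) M archPk archSub (frameVolumePiecesDHArch X hlog hc).Adm
    (frameVolumePiecesDHArch X hlog hc).logvol Ψ act Mmod region

/-- Every line of `situationDHFramesArch` carries the pieces' volumes (by `rfl`). [folklore] -/
theorem realizes_situationDHFramesArch :
    (frameVolumePiecesDHArch X hlog hc).Realizes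
      ((situationDHFramesArch X hlog hc M archPk archSub Ψ act Mmod region).D n) :=
  ⟨fun _ _ _ => Iff.rfl, fun _ _ _ => rfl⟩

variable {HT : Type} {LogLink : HT → HT → Type} {IsFull : ∀ {s t : HT}, LogLink s t → Prop}
  (lat : LGPGaussianLogThetaLattice LogLink IsFull)
  {Frd : Type} {IsoF : Frd → Frd → Type} {Ob : Frd → Type} {realify : Frd → Frd} {Strip : Type}
  {IsoS : Strip → Strip → Type} {Mv : ∀ v : (thetaIndex X).V, v ∈ (thetaIndex X).Vbad → Type}
  [∀ v h, Monoid (Mv v h)]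
  (sig : GlobalLGPFrobenioidSignature (thetaIndex X).lstar (thetaIndex X).V (· ∈ (thetaIndex X).Vbad)
    Frd IsoF Ob realify Strip IsoS Mv)
  (split : SplittingMonoids Mv) {ObΔ : Type} {N : ∀ v : (thetaIndex X).V, v ∈ (thetaIndex X).Vbad → Type}
  [∀ v h, Monoid (N v h)] (qData : QPilotData ObΔ N)
  (thetaBox : ℤ → Ob sig.Clgp → ∀ (j : (thetaIndex X).Label) (vQ : (thetaIndex X).VQ),
    Set (∀ s : factorIdxDHArch X hlog j vQ, factorFieldDHArch X hlog j vQ s))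
  (qCentre : ObΔ → ∀ (j : (thetaIndex X).Label) (vQ : (thetaIndex X).VQ),
    ∀ s : factorIdxDHArch X hlog j vQ, factorFieldDHArch X hlog j vQ s)
  (hq : ∀ j vQ s, qCentre (qPilotObject qData) j vQ s ≠ 0)
  (hfin : ∀ j : (thetaIndex X).Label, (Function.support fun vQ =>
    ((situationDHVolArch X hlog hc M archPk archSub Ψ act Mmod region).D n).logvol j vQ
      (factorMapDHArch X hlog hc j vQ ⁻¹' hullSet (factorFieldDHArch X hlog j vQ)
        (qCentre (qPilotObject qData) j vQ))).Finite)

include hq in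
/-- The `q`-support agrees in the two containers, so `settingDHVolArch`'s `hfin` serves both. [folklore] -/
theorem qSupport_framesArch_eq (j : (thetaIndex X).Label) :
    (Function.support fun vQ => ((situationDHFramesArch X hlog hc M archPk archSub Ψ act Mmod region).D n).logvol j vQ
      (factorMapDHArch X hlog hc j vQ ⁻¹' hullSet (factorFieldDHArch X hlog j vQ) (qCentre (qPilotObject qData) j vQ))) =
    (Function.support fun vQ => ((situationDHVolArch X hlog hc M archPk archSub Ψ act Mmod region).D n).logvol j vQ
      (factorMapDHArch X hlog hc j vQ ⁻¹' hullSet (factorFieldDHArch X hlog j vQ) (qCentre (qPilotObject qData) j vQ))) := by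
  ext vQ
  simp only [Function.mem_support, ne_eq]
  rw [show ((situationDHFramesArch X hlog hc M archPk archSub Ψ act Mmod region).D n).logvol j vQ
      (factorMapDHArch X hlog hc j vQ ⁻¹' hullSet (factorFieldDHArch X hlog j vQ) (qCentre (qPilotObject qData) j vQ)) =
      (frameVolumePiecesDHArch X hlog hc).logvol j vQ
        (factorMapDHArch X hlog hc j vQ ⁻¹' hullSet (factorFieldDHArch X hlog j vQ) (qCentre (qPilotObject qData) j vQ))
      from rfl,
    logvol_frameVolumePiecesDHArch_preimage_hullSet X hlog hc M archPk archSub Ψ act Mmod region n j vQ _ (hq j vQ)]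

/-- **The setting of [IUTchIII] Cor. 3.12 over the REAL log-shells of `F`, field-box volumes with RADIAL archimedean
factors** — c312-7's `Setting.ofFrames` over the pieces' `toRealFrames thetaBox qCentre`, `hadm` DISCHARGED
(c312-6 `hadm_of_realizes`), with EXACTLY the binders of w5-d163's `Real.settingDHVolArch` (`hfin` transported).
[claim: Mochizuki2012, status: disputed] -/
def settingDHFramesArch : Cor312.Setting (situationDHFramesArch X hlog hc M archPk archSub Ψ act Mmod region) :=
  Setting.ofFrames n lat sig split qData
    (FrameVolumePieces.toRealFrames (S := situationDHFramesArch X hlog hc M archPk archSub Ψ act Mmod region)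
      (frameVolumePiecesDHArch X hlog hc) thetaBox qCentre) hq
    (FrameVolumePieces.hadm_of_realizes (S := situationDHFramesArch X hlog hc M archPk archSub Ψ act Mmod region)
      (V := frameVolumePiecesDHArch X hlog hc)
      (realizes_situationDHFramesArch X hlog hc M archPk archSub Ψ act Mmod region n))
    (fun j => (qSupport_framesArch_eq X hlog hc M archPk archSub Ψ act Mmod region n qData qCentre hq j).symm ▸ hfin j)

/-- Same hull frames as `settingDHVolArch` (both are `Setting.ofFrames` over the same frames). [folklore] -/
theorem frame_settingDHFramesArch (j : (thetaIndex X).Label) (vQ : (thetaIndex X).VQ) :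
    (settingDHFramesArch X hlog hc M archPk archSub Ψ act Mmod region n lat sig split qData thetaBox qCentre hq
        hfin).frame j vQ =
      (settingDHVolArch X hlog hc M archPk archSub Ψ act Mmod region n lat sig split qData thetaBox qCentre hq
        hfin).frame j vQ :=
  rfl

/-- Same possible images of the Θ-pilot object. [folklore] -/
theorem possibleImages_settingDHFramesArch (j : (thetaIndex X).Label) (vQ : (thetaIndex X).VQ) :
    (settingDHFramesArch X hlog hc M archPk archSub Ψ act Mmod region n lat sig split qData thetaBox qCentre hq
        hfin).possibleImages j vQ =
      (settingDHVolArch X hlog hc M archPk archSub Ψ act Mmod region n lat sig split qData thetaBox qCentre hq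
        hfin).possibleImages j vQ :=
  rfl

/-- Same `HullDefined`. [folklore] -/
theorem hullDefined_settingDHFramesArch_iff (j : (thetaIndex X).Label) (vQ : (thetaIndex X).VQ) :
    (settingDHFramesArch X hlog hc M archPk archSub Ψ act Mmod region n lat sig split qData thetaBox qCentre hq
        hfin).HullDefined j vQ ↔
      (settingDHVolArch X hlog hc M archPk archSub Ψ act Mmod region n lat sig split qData thetaBox qCentre hq
        hfin).HullDefined j vQ :=
  Iff.rfl

/-- **Same local `q`-volume** (§2 at `λ_q·𝒪_L`, `λ_q ≠ 0`). [claim: Mochizuki2012, status: disputed] -/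
theorem qLocal_settingDHFramesArch (j : (thetaIndex X).Label) (vQ : (thetaIndex X).VQ) :
    (settingDHFramesArch X hlog hc M archPk archSub Ψ act Mmod region n lat sig split qData thetaBox qCentre hq
        hfin).qLocal j vQ =
      (settingDHVolArch X hlog hc M archPk archSub Ψ act Mmod region n lat sig split qData thetaBox qCentre hq
        hfin).qLocal j vQ := by
  show (frameVolumePiecesDHArch X hlog hc).logvol j vQ
      (factorMapDHArch X hlog hc j vQ ⁻¹' hullSet (factorFieldDHArch X hlog j vQ) (qCentre (qPilotObject qData) j vQ)) =
    ((situationDHVolArch X hlog hc M archPk archSub Ψ act Mmod region).D n).logvol j vQ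
      (factorMapDHArch X hlog hc j vQ ⁻¹' hullSet (factorFieldDHArch X hlog j vQ) (qCentre (qPilotObject qData) j vQ))
  exact logvol_frameVolumePiecesDHArch_preimage_hullSet X hlog hc M archPk archSub Ψ act Mmod region n j vQ _ (hq j vQ)

/-- **Same local `−|log(Θ)|`** (the hull, when defined, is the preimage of a hull-set of the common frame — a polydisc
at `∞` — on which the containers agree by §2; otherwise both read `+∞`). [claim: Mochizuki2012, status: disputed] -/
theorem thetaLocal_settingDHFramesArch (j : (thetaIndex X).Label) (vQ : (thetaIndex X).VQ) :
    (settingDHFramesArch X hlog hc M archPk archSub Ψ act Mmod region n lat sig split qData thetaBox qCentre hq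
        hfin).thetaLocal j vQ =
      (settingDHVolArch X hlog hc M archPk archSub Ψ act Mmod region n lat sig split qData thetaBox qCentre hq
        hfin).thetaLocal j vQ := by
  set P₂ := settingDHVolArch X hlog hc M archPk archSub Ψ act Mmod region n lat sig split qData thetaBox qCentre hq
    hfin with hP₂
  unfold Cor312.Setting.thetaLocal
  by_cases h : P₂.HullDefined j vQ
  · rw [if_pos (show (settingDHFramesArch X hlog hc M archPk archSub Ψ act Mmod region n lat sig split qData thetaBox
        qCentre hq hfin).HullDefined j vQ from h), if_pos h]
    congr 1
    obtain ⟨H', hH', hEq⟩ := (P₂.frame j vQ).hull_mem_of_hasHull h.1 h.2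
    show (frameVolumePiecesDHArch X hlog hc).logvol j vQ (P₂.thetaHull j vQ) =
      ((situationDHVolArch X hlog hc M archPk archSub Ψ act Mmod region).D n).logvol j vQ (P₂.thetaHull j vQ)
    rw [show P₂.thetaHull j vQ = factorMapDHArch X hlog hc j vQ ⁻¹' H' from hEq]
    exact logvol_frameVolumePiecesDHArch_preimage_of_isHullSet X hlog hc M archPk archSub Ψ act Mmod region n j vQ
      ((frameKDHArch_hul_iff X hlog j vQ H').mp hH')
  · rw [if_neg (show ¬ (settingDHFramesArch X hlog hc M archPk archSub Ψ act Mmod region n lat sig split qData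
        thetaBox qCentre hq hfin).HullDefined j vQ from h), if_neg h]

/-- **Same `ThetaFinite`.** [claim: Mochizuki2012, status: disputed] -/
theorem thetaFinite_settingDHFramesArch_iff :
    (settingDHFramesArch X hlog hc M archPk archSub Ψ act Mmod region n lat sig split qData thetaBox qCentre hq
        hfin).ThetaFinite ↔
      (settingDHVolArch X hlog hc M archPk archSub Ψ act Mmod region n lat sig split qData thetaBox qCentre hq
        hfin).ThetaFinite := by
  simp only [Cor312.Setting.ThetaFinite, thetaLocal_settingDHFramesArch]

/-- **Same `−|log(Θ)|`.** [claim: Mochizuki2012, status: disputed] -/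
theorem negLogTheta_settingDHFramesArch :
    (settingDHFramesArch X hlog hc M archPk archSub Ψ act Mmod region n lat sig split qData thetaBox qCentre hq
        hfin).negLogTheta =
      (settingDHVolArch X hlog hc M archPk archSub Ψ act Mmod region n lat sig split qData thetaBox qCentre hq
        hfin).negLogTheta := by
  unfold Cor312.Setting.negLogTheta
  by_cases h : (settingDHVolArch X hlog hc M archPk archSub Ψ act Mmod region n lat sig split qData thetaBox qCentre
      hq hfin).ThetaFinite
  · rw [if_pos ((thetaFinite_settingDHFramesArch_iff X hlog hc M archPk archSub Ψ act Mmod region n lat sig split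
      qData thetaBox qCentre hq hfin).mpr h), if_pos h]
    simp only [thetaLocal_settingDHFramesArch]
  · rw [if_neg (mt (thetaFinite_settingDHFramesArch_iff X hlog hc M archPk archSub Ψ act Mmod region n lat sig split
      qData thetaBox qCentre hq hfin).mp h), if_neg h]

/-- **Same `−|log(q)|`.** [claim: Mochizuki2012, status: disputed] -/
theorem negLogQ_settingDHFramesArch :
    (settingDHFramesArch X hlog hc M archPk archSub Ψ act Mmod region n lat sig split qData thetaBox qCentre hq
        hfin).negLogQ =
      (settingDHVolArch X hlog hc M archPk archSub Ψ act Mmod region n lat sig split qData thetaBox qCentre hq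
        hfin).negLogQ := by
  unfold Cor312.Setting.negLogQ
  simp only [qLocal_settingDHFramesArch]

/-- **CONTAINER-ROBUSTNESS, archimedean place honest.** The printed statement "`−|log(Θ)| ∈ ℝ` and
`−|log(Θ)| ≥ −|log(q)|`" ([IUTchIII] Cor. 3.12, kurims p. 174 l. 16–18; c312-7 `Cor312.Setting.Statement`) holds for the
real log-shells of `F` with `𝕄(−)` read as boxes over the field factors with RADIAL archimedean factor volumes
(`Real.settingDHFramesArch`) iff it holds with the verbatim summandwise container, archimedean place honest
(w5-d163 `Real.settingDHVolArch`). Neither side is asserted. [claim: Mochizuki2012, status: disputed] -/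
theorem statement_settingDHFramesArch_iff :
    (settingDHFramesArch X hlog hc M archPk archSub Ψ act Mmod region n lat sig split qData thetaBox qCentre hq
        hfin).Statement ↔
      (settingDHVolArch X hlog hc M archPk archSub Ψ act Mmod region n lat sig split qData thetaBox qCentre hq
        hfin).Statement := by
  unfold Cor312.Setting.Statement
  rw [negLogTheta_settingDHFramesArch, negLogQ_settingDHFramesArch]

end Agreement

end Real

end Thm311

end IUTFork

end Summit.ABC

end
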